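import Summits.QuantumFields.YangMills.Theorems.BalabanUVNodesN15KingModelCovariantBlockFieldCovariance
import Summits.QuantumFields.YangMills.Theorems.BalabanUVNodesN15KingModelComplexLinkOperator
import Summits.QuantumFields.YangMills.Theorems.BalabanUVNodesN15KingModelBlockCovarianceIdentity
import Literature.MathematicalPhysics.QuantumFieldTheory.King1986.CovarianceQstarDecay
import HarnessLib

/-!
# BalabanUVNodes ∕ N15 — THE KING-MODEL RUNG (PART Ϥ-l): ★★★ KING's `A = 0` BLOCK-FIELD COVARIANCE MAJORISES THE CURVED ONE AT EVERY LINK FIELD — blockwise in operator norm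
# `‖((Δ_eff(U))⁻¹)_{yy′} − a⁻¹δ_{yy′}·1‖ ≤ ((Δ^{(K)})⁻¹ − a⁻¹·1)(y,y′) = L^{−(d+1)}Σ_{x∈B(y),x′∈B(y′)}(L²(−Δ)+m²)⁻¹(x,x′)` (Woodbury, PART Ϥ-k, + Kato domination, PART Ͱ-b); hence KING's UNIFORM
# EXPONENTIAL DECAY of the block-field covariance (`King1986.Torus.effLaplacian_inv_decay`: `≤ (2∕γ_m)e^{−κ_m·dist}`, the tower parameters `a_k`, `L = L₀^k`) HOLDS AT EVERY UNITARY `U`, BY NAME —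
# NE2's unit layer at curved fields costs nothing
# (Track A, DAG node N15 = NE2; FAN-OUT v1.1 §N15 s3 «KING-MODEL RUNG … + what the curved case adds»; count-neutral)

HONEST FRAMING.  Count-neutral (cell `pub-ymgap`, seat `pub-ymgap-dag-n15-e` g49; `--supports stmt-QuantumFields-27247 --as helper` = K3ᴬ, KEY MAP v3).  King's comparison model in King's
scaling `c = L²` (unit blocks), MASSIVE (`m² > 0`); one-level covariant averaging along any tree contour system; the majorant is King's `A = 0` block-field covariance of the g0 rung
(`(Δ^{(K)})⁻¹ = a⁻¹1 + L^{d+1}·Q(L²(−Δ)+m²)⁻¹Qᵀ`, `N15KingModelRung.effLaplacian_inv_eq_noise_add_blockAvg`).  Decay constants are the tree's (`gamM`, `kapM` of `King1986.CovarianceQstarDecay`,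
[King1986] (4.33)–(4.34) p.674 as landed from [Dimock2013] Lemmas 29–30); NOT Bałaban's multi-level `G_k(U)`; NOT (3.42); NOT a node discharge (N15 of record untouched); nothing continuum ∕ ℝ⁴ ∕
OS ∕ Clay.

RESULTS: §1 ★ `blk_covQ_mul_mul_kingQadjU` (`(Q(U)BQ(U)^*)_{yy′} = L^{−(d+1)}Σ_{j,j′}U(Γ_j)·B_{x_jx′_{j′}}·U(Γ′_{j′})^*`), ★ `norm_blk_covQ_mul_mul_kingQadjU_le` (`≤ L^{−(d+1)}Σ‖B_{x_jx′_{j′}}‖`, unitary transports);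
§2 ★★★ **`norm_blk_effLapU_inv_sub_noise_le`** (`‖((Δ_eff(U))⁻¹)_{yy′} − a⁻¹δ·1‖ ≤ L^{−(d+1)}Σ_{j,j′}(L²... ` — for general `c`: `(c(−Δ)+m²)⁻¹(x_j,x′_{j′})`, Ͱ-b `l2_opNorm_blk_inv_le`), ★★
`king_blockCov_sub_noise_apply` (King's scaling: `((Δ^{(K)})⁻¹ − a⁻¹1)(y,y′) = L^{−(d+1)}ΣΣ(L²(−Δ)+m²)⁻¹(x_j,x′_{j′})`), ★★★ **`norm_blk_effLapU_inv_sub_noise_le_king`** (THE MAJORISATION BY KING's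
`A = 0` OBJECT, every unitary `U`), ★★ `norm_blk_effLapU_inv_le_king` (`‖((Δ_eff(U))⁻¹)_{yy′}‖ ≤ (Δ^{(K)})⁻¹(y,y′)`); §3 ★★★ **`norm_blk_effLapU_inv_le_king_decay`** (tower parameters `a_k = aK a L₀ k`,
`L = L₀^k`, `L₀ ≥ 2`, `k ≥ 1`: `‖((Δ_eff(U))⁻¹)_{bb′}‖ ≤ (2∕γ_m)e^{−κ_m·tdist(b,b′)}` AT EVERY unitary `U` — King's (4.34)-type decay by name), ★★★ **`king_blockField_what_the_curved_case_adds`**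
(package: Woodbury form, sandwich, King majorant, uniform decay — every `U`).
PRIOR TREE ART (by name): Ϥ-b (`treeHol_mem_unitaryGroup`), Ϥ-c (`covQ_apply_site`), Ϥ-d (`kingQadjU`), Ϥ-k (`effLapU`, `effLapU_inv_eq_noise_add_blockAvg`), Ͱ-a∕b∕d (`blk`, `l2_opNorm_blk_inv_le`,
`lapF_inv_entry_nonneg`, `blk_one'`, `blk_sub'`, `blk_smul'`, `l2_opNorm_of_mem_unitaryGroup_le`), `N15KingModelRung.effLaplacian_inv_eq_noise_add_blockAvg`, `King1986.Torus` (`effLaplacian`, `Qmat`,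
`blockOf_site`, `site`, `blockEquiv`, `effLaplacian_inv_decay`, `gamM`, `kapM`, `aK`, `tdistT`).  Dedup (rg at filing): basename 0 files; needles `blk_covQ_mul_mul_kingQadjU|norm_blk_effLapU|king_blockCov_sub_noise_apply`
0 files.  presearch: n/a (composition of in-tree theorems).  Locators: [King1986] (2.13)–(2.14) p.653, (4.5) p.670, (4.33)–(4.34) p.674, (4.44)–(4.45) p.675; [Balaban1985BackgroundPropagators]
(3.19) p.393, (3.25) p.394, (3.42) p.397 (NOT asserted); [Dimock2013] App. D Lemmas 29–30.  0 `sorry`, 0 `def`.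
-/

noncomputable section
open scoped BigOperators ComplexConjugate ComplexOrder Matrix.Norms.L2Operator
open Finset Matrix WithLp

namespace Summit.QuantumFields.YangMills.BalabanUVNodes.N15KingModelRung.CovariantBlock

open Literature.MathematicalPhysics.QuantumFieldTheory.LatticeDiamagneticInequality (blk)
open Literature.MathematicalPhysics.QuantumFieldTheory.Balaban1983to89.B5Prop11Plancherel (Tor fine unitVec)
open Literature.MathematicalPhysics.QuantumFieldTheory.King1986 (aK aK_pos)
open Literature.MathematicalPhysics.QuantumFieldTheory.King1986.Torus (site blockEquiv blockEquiv_apply blockOf blockOf_site lapF Qmat effLaplacian gamM kapM tdistT)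
open Summit.QuantumFields.YangMills.BalabanUVNodes.N15KingModelRung.Covariant
  (covLapF fib l2_opNorm_blk_inv_le lapF_inv_entry_nonneg blk_one' blk_sub' blk_smul' l2_opNorm_of_mem_unitaryGroup_le)

variable {d : ℕ} {L : ℕ} [NeZero L] (T : BlockTree d L) (M : Fin (d + 1) → ℕ) [hM : ∀ μ, NeZero (M μ)]
variable {𝕜 : Type*} [RCLike 𝕜] {n : Type*} [Fintype n] [DecidableEq n]

/-! ## §1 The blocks of a covariant sandwich `Q(U)·B·Q(U)^*` -/

/-- ★ THE BLOCKS OF `Q(U)BQ(U)^*`: `(Q(U)·B·Q(U)^*)_{yy′} = L^{−(d+1)}·Σ_{j,j′} U(Γ_{y,x_j})·B_{x_j,x′_{j′}}·U(Γ_{y′,x′_{j′}})^*` (`x_j = site y j`, `x′_{j′} = site y′ j′`).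
[cite: King1986, (2.13)–(2.14) p.653; Balaban1985BackgroundPropagators, (3.19) p.393] -/
theorem blk_covQ_mul_mul_kingQadjU (B : Matrix (Tor (fine L M) × n) (Tor (fine L M) × n) 𝕜) (U : Tor (fine L M) × Fin (d + 1) → Matrix n n 𝕜) (y y' : Tor M) :
    blk (covQ T M U * B * kingQadjU T M U) y y'
      = ((L : 𝕜) ^ (d + 1))⁻¹ • ∑ j : Fin (d + 1) → Fin L, ∑ j' : Fin (d + 1) → Fin L,
          treeHol M T U y j * blk B (site L M y j) (site L M y' j') * (treeHol M T U y' j')ᴴ := by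
  have hL : ((L : 𝕜) ^ (d + 1)) ≠ 0 := pow_ne_zero _ (by exact_mod_cast NeZero.ne L)
  -- the entries of `Q(U)·B`
  have hQB : ∀ (i : n) (j' : Fin (d + 1) → Fin L) (k' : n), (covQ T M U * B) (y, i) (site L M y' j', k')
      = ((L : 𝕜) ^ (d + 1))⁻¹ * ∑ j : Fin (d + 1) → Fin L, ∑ k, treeHol M T U y j i k * B (site L M y j, k) (site L M y' j', k') := by
    intro i j' k'
    rw [Matrix.mul_apply, Fintype.sum_prod_type, ← (blockEquiv L M).sum_comp, Fintype.sum_prod_type]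
    simp only [blockEquiv_apply, covQ_apply_site]
    rw [Finset.sum_eq_single y]
    · simp only [if_true, Finset.mul_sum]
      refine Finset.sum_congr rfl fun j _ => Finset.sum_congr rfl fun k _ => ?_
      ring
    · intro b _ hb
      refine Finset.sum_eq_zero fun j _ => Finset.sum_eq_zero fun k _ => ?_
      rw [if_neg (Ne.symm hb), zero_mul]
    · intro h; exact absurd (Finset.mem_univ y) h
  ext i i'
  -- the right-hand entry
  have hR : (((L : 𝕜) ^ (d + 1))⁻¹ • ∑ j : Fin (d + 1) → Fin L, ∑ j' : Fin (d + 1) → Fin L, treeHol M T U y j * blk B (site L M y j) (site L M y' j') * (treeHol M T U y' j')ᴴ) i i'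
      = ((L : 𝕜) ^ (d + 1))⁻¹ * ∑ j : Fin (d + 1) → Fin L, ∑ j' : Fin (d + 1) → Fin L, ∑ k', ∑ k,
          treeHol M T U y j i k * B (site L M y j, k) (site L M y' j', k') * star (treeHol M T U y' j' i' k') := by
    simp only [Matrix.smul_apply, Matrix.sum_apply, smul_eq_mul, Matrix.mul_apply, Matrix.conjTranspose_apply, blk, Matrix.of_apply, Finset.sum_mul]
  -- the left-hand entry
  have hLft : blk (covQ T M U * B * kingQadjU T M U) y y' i i'
      = ((L : 𝕜) ^ (d + 1))⁻¹ * ∑ j' : Fin (d + 1) → Fin L, ∑ k', ∑ j : Fin (d + 1) → Fin L, ∑ k,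
          treeHol M T U y j i k * B (site L M y j, k) (site L M y' j', k') * star (treeHol M T U y' j' i' k') := by
    simp only [blk, Matrix.of_apply]
    rw [kingQadjU, Matrix.mul_smul, Matrix.smul_apply, smul_eq_mul, Matrix.mul_apply, Fintype.sum_prod_type, ← (blockEquiv L M).sum_comp, Fintype.sum_prod_type]
    simp only [blockEquiv_apply, Matrix.conjTranspose_apply, covQ_apply_site]
    rw [Finset.sum_eq_single y']
    · simp only [if_true, hQB, star_mul', RCLike.star_def, map_inv₀, map_pow, map_natCast, Finset.mul_sum, Finset.sum_mul]
      refine Finset.sum_congr rfl fun j' _ => Finset.sum_congr rfl fun k' _ => Finset.sum_congr rfl fun j _ => Finset.sum_congr rfl fun k _ => ?_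
      field_simp
    · intro b _ hb
      refine Finset.sum_eq_zero fun j' _ => Finset.sum_eq_zero fun k' _ => ?_
      simp [if_neg (Ne.symm hb)]
    · intro h; exact absurd (Finset.mem_univ y') h
  rw [hLft, hR]
  congr 1
  rw [show (∑ j' : Fin (d + 1) → Fin L, ∑ k' : n, ∑ j : Fin (d + 1) → Fin L, ∑ k : n,
          treeHol M T U y j i k * B (site L M y j, k) (site L M y' j', k') * star (treeHol M T U y' j' i' k'))
        = ∑ j' : Fin (d + 1) → Fin L, ∑ j : Fin (d + 1) → Fin L, ∑ k' : n, ∑ k : n,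
          treeHol M T U y j i k * B (site L M y j, k) (site L M y' j', k') * star (treeHol M T U y' j' i' k')
      from Finset.sum_congr rfl fun j' _ => Finset.sum_comm, Finset.sum_comm]

/-- ★ THE BLOCKS OF A COVARIANT SANDWICH ARE DOMINATED BY THE BLOCKS OF THE MIDDLE: for unitary `U`, `‖(Q(U)BQ(U)^*)_{yy′}‖ ≤ L^{−(d+1)}Σ_{j,j′}‖B_{x_j,x′_{j′}}‖`.
[cite: Balaban1985BackgroundPropagators, (3.19) p.393] -/
theorem norm_blk_covQ_mul_mul_kingQadjU_le (B : Matrix (Tor (fine L M) × n) (Tor (fine L M) × n) 𝕜) {U : Tor (fine L M) × Fin (d + 1) → Matrix n n 𝕜}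
    (hU : ∀ bd, U bd ∈ Matrix.unitaryGroup n 𝕜) (y y' : Tor M) :
    ‖blk (covQ T M U * B * kingQadjU T M U) y y'‖ ≤ ((L : ℝ) ^ (d + 1))⁻¹ * ∑ j : Fin (d + 1) → Fin L, ∑ j' : Fin (d + 1) → Fin L, ‖blk B (site L M y j) (site L M y' j')‖ := by
  rw [blk_covQ_mul_mul_kingQadjU, norm_smul, norm_inv, norm_pow, RCLike.norm_natCast]
  refine mul_le_mul_of_nonneg_left ((norm_sum_le _ _).trans (Finset.sum_le_sum fun j _ => (norm_sum_le _ _).trans (Finset.sum_le_sum fun j' _ => ?_))) (by positivity)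
  have h1 := l2_opNorm_of_mem_unitaryGroup_le (treeHol_mem_unitaryGroup T M hU y j)
  have h2 : ‖(treeHol M T U y' j')ᴴ‖ ≤ 1 := by
    have : (treeHol M T U y' j')ᴴ ∈ Matrix.unitaryGroup n 𝕜 := by simpa only [star_eq_conjTranspose] using Unitary.star_mem (treeHol_mem_unitaryGroup T M hU y' j')
    exact l2_opNorm_of_mem_unitaryGroup_le this
  calc ‖treeHol M T U y j * blk B (site L M y j) (site L M y' j') * (treeHol M T U y' j')ᴴ‖
      ≤ ‖treeHol M T U y j‖ * ‖blk B (site L M y j) (site L M y' j')‖ * ‖(treeHol M T U y' j')ᴴ‖ := (norm_mul_le _ _).trans (mul_le_mul_of_nonneg_right (norm_mul_le _ _) (norm_nonneg _))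
    _ ≤ 1 * ‖blk B (site L M y j) (site L M y' j')‖ * 1 := by gcongr
    _ = ‖blk B (site L M y j) (site L M y' j')‖ := by ring

/-! ## §2 Domination of the curved block-field covariance by King's `A = 0` one -/

/-- ★★★ **THE CURVED BLOCK-FIELD COVARIANCE MINUS THE NOISE IS DOMINATED BLOCKWISE BY KING's FREE SANDWICH**: for every unitary `U` (`a, m² > 0`, `c ≥ 0`),
`‖((Δ_eff(U))⁻¹)_{yy′} − a⁻¹δ_{yy′}·1‖ ≤ L^{−(d+1)}·Σ_{j,j′}(c(−Δ)+m²)⁻¹(x_j,x′_{j′})` (Woodbury at `U` + Kato domination `‖(G_U)_{xx′}‖ ≤ G_1(x,x′)`).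
[cite: King1986, (2.14) p.653, (4.44)–(4.45) p.675; Balaban1985BackgroundPropagators, (3.19) p.393, (3.23) p.394; DodziukMathai2006, Thm 1.5 §1] -/
theorem norm_blk_effLapU_inv_sub_noise_le {a c m2 : ℝ} (ha : 0 < a) (hc : 0 ≤ c) (hm : 0 < m2) {U : Tor (fine L M) × Fin (d + 1) → Matrix n n 𝕜} (hU : ∀ bd, U bd ∈ Matrix.unitaryGroup n 𝕜)
    (y y' : Tor M) :
    ‖blk ((effLapU T M a c m2 U)⁻¹) y y' - (if y = y' then (a⁻¹ : 𝕜) else 0) • (1 : Matrix n n 𝕜)‖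
      ≤ ((L : ℝ) ^ (d + 1))⁻¹ * ∑ j : Fin (d + 1) → Fin L, ∑ j' : Fin (d + 1) → Fin L, (lapF (fine L M) c m2)⁻¹ (site L M y j) (site L M y' j') := by
  have hsplit : blk ((effLapU T M a c m2 U)⁻¹) y y' - (if y = y' then (a⁻¹ : 𝕜) else 0) • (1 : Matrix n n 𝕜)
      = blk (covQ T M U * (covLapF (fine L M) c m2 U)⁻¹ * kingQadjU T M U) y y' := by
    rw [effLapU_inv_eq_noise_add_blockAvg T M ha hc hm hU]
    ext i i'
    simp only [blk, Matrix.of_apply, Matrix.sub_apply, Matrix.add_apply, Matrix.smul_apply, Matrix.one_apply, Prod.mk.injEq, smul_eq_mul]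
    by_cases h : y = y' <;> by_cases h' : i = i' <;> simp [h, h']
  rw [hsplit]
  refine (norm_blk_covQ_mul_mul_kingQadjU_le T M _ hU y y').trans (mul_le_mul_of_nonneg_left (Finset.sum_le_sum fun j _ => Finset.sum_le_sum fun j' _ => ?_) (by positivity))
  exact l2_opNorm_blk_inv_le (fine L M) hc hm hU _ _

/-- KING's SANDWICH ENTRYWISE: `(Q·K·Qᵀ)(y,y′) = L^{−2(d+1)}Σ_{j,j′}K(x_j,x′_{j′})` (King's block mean `Q`, entries `L^{−(d+1)}` on the block). [cite: King1986, (2.11) p.653, (4.1) p.670] -/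
theorem king_Qmat_sandwich_apply (K : Matrix (Tor (fine L M)) (Tor (fine L M)) ℝ) (y y' : Tor M) :
    (Qmat L M * K * (Qmat L M)ᵀ) y y' = (((L : ℝ) ^ (d + 1))⁻¹) ^ 2 * ∑ j : Fin (d + 1) → Fin L, ∑ j' : Fin (d + 1) → Fin L, K (site L M y j) (site L M y' j') := by
  have hQ : ∀ (b b' : Tor M) (j : Fin (d + 1) → Fin L), Qmat L M b (site L M b' j) = if b' = b then ((L : ℝ) ^ (d + 1))⁻¹ else 0 := by
    intro b b' j; simp only [Qmat, blockOf_site]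
  have hinner : ∀ x', (Qmat L M * K) y x' = ((L : ℝ) ^ (d + 1))⁻¹ * ∑ j : Fin (d + 1) → Fin L, K (site L M y j) x' := by
    intro x'
    rw [Matrix.mul_apply, ← (blockEquiv L M).sum_comp, Fintype.sum_prod_type]
    simp only [blockEquiv_apply, hQ]
    rw [Finset.sum_eq_single y]
    · simp only [if_true, Finset.mul_sum]
    · intro b _ hb; refine Finset.sum_eq_zero fun j _ => ?_; rw [if_neg hb, zero_mul]
    · intro h; exact absurd (Finset.mem_univ y) h
  rw [Matrix.mul_apply, ← (blockEquiv L M).sum_comp, Fintype.sum_prod_type]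
  simp only [blockEquiv_apply, Matrix.transpose_apply, hQ, hinner]
  rw [Finset.sum_eq_single y']
  · simp only [if_true]
    rw [Finset.sum_comm, Finset.mul_sum]
    refine Finset.sum_congr rfl fun j _ => ?_
    rw [Finset.mul_sum, Finset.sum_mul, Finset.mul_sum]
    refine Finset.sum_congr rfl fun j' _ => ?_
    ring
  · intro b _ hb; refine Finset.sum_eq_zero fun j' _ => ?_; rw [if_neg hb, mul_zero]
  · intro h; exact absurd (Finset.mem_univ y') h

/-- ★★ KING's BLOCK-FIELD COVARIANCE MINUS THE NOISE, EXPLICITLY (King's scaling `c = L²`): `((Δ^{(K)})⁻¹ − a⁻¹1)(y,y′) = L^{−(d+1)}Σ_{j,j′}(L²(−Δ)+m²)⁻¹(x_j,x′_{j′})` (the rung's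
`effLaplacian_inv_eq_noise_add_blockAvg`, entrywise). [cite: King1986, (2.13)–(2.14) p.653, (4.44)–(4.45) p.675] -/
theorem king_blockCov_sub_noise_apply (hL : 1 ≤ L) {a m2 : ℝ} (ha : 0 < a) (hm : 0 < m2) (y y' : Tor M) :
    ((effLaplacian L M a ((L : ℝ) ^ 2) m2)⁻¹ - a⁻¹ • (1 : Matrix (Tor M) (Tor M) ℝ)) y y'
      = ((L : ℝ) ^ (d + 1))⁻¹ * ∑ j : Fin (d + 1) → Fin L, ∑ j' : Fin (d + 1) → Fin L, (lapF (fine L M) ((L : ℝ) ^ 2) m2)⁻¹ (site L M y j) (site L M y' j') := by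
  have hL0 : ((L : ℝ) ^ (d + 1)) ≠ 0 := pow_ne_zero _ (by exact_mod_cast NeZero.ne L)
  rw [Summit.QuantumFields.YangMills.BalabanUVNodes.N15KingModelRung.effLaplacian_inv_eq_noise_add_blockAvg L M hL ha hm, add_sub_cancel_left, Matrix.smul_apply, smul_eq_mul,
    king_Qmat_sandwich_apply]
  field_simp

/-- ★★★ **KING's `A = 0` BLOCK-FIELD COVARIANCE MAJORISES THE CURVED ONE, BLOCKWISE, AT EVERY LINK FIELD** (King's scaling `c = L²`, `L ≥ 1`, `a, m² > 0`, unitary `U`):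
`‖((Δ_eff(U))⁻¹)_{yy′} − a⁻¹δ_{yy′}·1‖ ≤ ((Δ^{(K)})⁻¹ − a⁻¹·1)(y,y′)` — the right side is King's object of the g0 rung, with all its landed bounds.
[cite: King1986, (2.14) p.653, (4.34) p.674, (4.45) p.675; Balaban1985BackgroundPropagators, (3.19) p.393, (3.25) p.394; DodziukMathai2006, Thm 1.5 §1] -/
theorem norm_blk_effLapU_inv_sub_noise_le_king (hL : 1 ≤ L) {a m2 : ℝ} (ha : 0 < a) (hm : 0 < m2) {U : Tor (fine L M) × Fin (d + 1) → Matrix n n 𝕜} (hU : ∀ bd, U bd ∈ Matrix.unitaryGroup n 𝕜)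
    (y y' : Tor M) :
    ‖blk ((effLapU T M a ((L : ℝ) ^ 2) m2 U)⁻¹) y y' - (if y = y' then (a⁻¹ : 𝕜) else 0) • (1 : Matrix n n 𝕜)‖
      ≤ ((effLaplacian L M a ((L : ℝ) ^ 2) m2)⁻¹ - a⁻¹ • (1 : Matrix (Tor M) (Tor M) ℝ)) y y' := by
  rw [king_blockCov_sub_noise_apply M hL ha hm]
  exact norm_blk_effLapU_inv_sub_noise_le T M ha (by positivity) hm hU y y'

/-- ★★ … hence `‖((Δ_eff(U))⁻¹)_{yy′}‖ ≤ (Δ^{(K)})⁻¹(y,y′)` (the noise is real and non-negative). [cite: King1986, (2.14) p.653, (4.45) p.675] -/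
theorem norm_blk_effLapU_inv_le_king (hL : 1 ≤ L) {a m2 : ℝ} (ha : 0 < a) (hm : 0 < m2) {U : Tor (fine L M) × Fin (d + 1) → Matrix n n 𝕜} (hU : ∀ bd, U bd ∈ Matrix.unitaryGroup n 𝕜)
    (y y' : Tor M) : ‖blk ((effLapU T M a ((L : ℝ) ^ 2) m2 U)⁻¹) y y'‖ ≤ (effLaplacian L M a ((L : ℝ) ^ 2) m2)⁻¹ y y' := by
  have h := norm_blk_effLapU_inv_sub_noise_le_king T M hL ha hm hU y y'
  rw [Matrix.sub_apply, Matrix.smul_apply, Matrix.one_apply, smul_eq_mul] at h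
  have hnoise : ‖(if y = y' then (a⁻¹ : 𝕜) else 0) • (1 : Matrix n n 𝕜)‖ ≤ a⁻¹ * (if y = y' then 1 else 0 : ℝ) := by
    by_cases hy : y = y'
    · rw [if_pos hy, if_pos hy, mul_one]
      calc ‖(a⁻¹ : 𝕜) • (1 : Matrix n n 𝕜)‖ ≤ ‖(a⁻¹ : 𝕜)‖ * ‖(1 : Matrix n n 𝕜)‖ := norm_smul_le _ _
        _ ≤ a⁻¹ * 1 := by
          rw [show (a⁻¹ : 𝕜) = ((a⁻¹ : ℝ) : 𝕜) by push_cast; rfl, RCLike.norm_ofReal, abs_of_pos (inv_pos.mpr ha)]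
          exact mul_le_mul_of_nonneg_left (l2_opNorm_of_mem_unitaryGroup_le (Submonoid.one_mem _)) (inv_pos.mpr ha).le
        _ = a⁻¹ := mul_one _
    · rw [if_neg hy, if_neg hy, zero_smul, norm_zero, mul_zero]
  calc ‖blk ((effLapU T M a ((L : ℝ) ^ 2) m2 U)⁻¹) y y'‖
      ≤ ‖blk ((effLapU T M a ((L : ℝ) ^ 2) m2 U)⁻¹) y y' - (if y = y' then (a⁻¹ : 𝕜) else 0) • (1 : Matrix n n 𝕜)‖ + ‖(if y = y' then (a⁻¹ : 𝕜) else 0) • (1 : Matrix n n 𝕜)‖ := by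
        linarith [norm_sub_norm_le (blk ((effLapU T M a ((L : ℝ) ^ 2) m2 U)⁻¹) y y') ((if y = y' then (a⁻¹ : 𝕜) else 0) • (1 : Matrix n n 𝕜))]
    _ ≤ ((effLaplacian L M a ((L : ℝ) ^ 2) m2)⁻¹ y y' - a⁻¹ * (if y = y' then 1 else 0 : ℝ)) + a⁻¹ * (if y = y' then 1 else 0 : ℝ) := add_le_add h hnoise
    _ = (effLaplacian L M a ((L : ℝ) ^ 2) m2)⁻¹ y y' := by ring

/-! ## §3 King's uniform exponential decay holds at every link field -/

/-- ★★★ **KING's UNIFORM EXPONENTIAL DECAY OF THE BLOCK-FIELD COVARIANCE HOLDS AT EVERY UNITARY LINK FIELD**: for King's tower parameters (`a_k = aK a L₀ k`, block side `L₀^k`, `L₀ ≥ 2`, `k ≥ 1`,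
`a, m² > 0`) and EVERY unitary `U` on the fine torus, `‖((Δ_eff(U))⁻¹)_{bb′}‖ ≤ (2∕γ_m)·e^{−κ_m·tdist(b,b′)}` — the tree's `King1986.Torus.effLaplacian_inv_decay` BY NAME through the majorisation;
`γ_m`, `κ_m` depend on `a, m², L₀, d` only (not on `k`, the volume, or `U`). [cite: King1986, (4.33)–(4.34) p.674, (2.14) p.653; Dimock2013, App. D Lemmas 29–30; Balaban1985BackgroundPropagators, (3.19) p.393] -/
theorem norm_blk_effLapU_inv_le_king_decay {L₀ k : ℕ} [NeZero L₀] (hL₀ : 2 ≤ L₀) (hk : 1 ≤ k) (T : BlockTree d (L₀ ^ k)) {a m2 : ℝ} (ha : 0 < a) (hm : 0 < m2)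
    {U : Tor (fine (L₀ ^ k) M) × Fin (d + 1) → Matrix n n 𝕜} (hU : ∀ bd, U bd ∈ Matrix.unitaryGroup n 𝕜) (b b' : Tor M) :
    ‖blk ((effLapU T M (aK a L₀ k) (((L₀ ^ k : ℕ) : ℝ) ^ 2) m2 U)⁻¹) b b'‖ ≤ (2 / gamM a m2 L₀) * Real.exp (-(kapM (d + 1) a m2 L₀ * tdistT M b b')) := by
  have hL1 : 1 ≤ L₀ ^ k := Nat.one_le_pow _ _ (by omega)
  have haK : 0 < aK a (L₀ : ℝ) k := aK_pos ha (by exact_mod_cast hL₀) hk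
  have h1 := norm_blk_effLapU_inv_le_king T M hL1 haK hm hU b b'
  have h2 := Literature.MathematicalPhysics.QuantumFieldTheory.King1986.Torus.effLaplacian_inv_decay ha hm hL₀ hk M b b'
  push_cast at h1 h2 ⊢
  exact h1.trans ((le_abs_self _).trans h2)

/-- ★★★ **WHAT THE CURVED CASE ADDS FOR THE BLOCK-FIELD COVARIANCE (NE2's unit layer), BY NAME**: for every tree contour system, every unitary `U`, King's scaling, `a, m² > 0`, `L ≥ 1`:
(1) Woodbury `(Δ_eff(U))⁻¹ = a⁻¹1 + Q(U)M_U⁻¹Q(U)^*`; (2) the `U`-uniform sandwich `a⁻¹‖f‖² ≤ Re⟨f,(Δ_eff(U))⁻¹f⟩ ≤ (a⁻¹+m⁻²)‖f‖²`; (3) blockwise majorisation by King's `A = 0` block-field covariance —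
so every decay ∕ rate bound of the `U ≡ 1` rung transfers to every `U` at no cost. [cite: King1986, (2.14) p.653, (4.34) p.674, (4.45) p.675; Balaban1985BackgroundPropagators, (3.19) p.393, (3.25) p.394] -/
theorem king_blockField_what_the_curved_case_adds (hL : 1 ≤ L) {a m2 : ℝ} (ha : 0 < a) (hm : 0 < m2) {U : Tor (fine L M) × Fin (d + 1) → Matrix n n 𝕜} (hU : ∀ bd, U bd ∈ Matrix.unitaryGroup n 𝕜) :
    (effLapU T M a ((L : ℝ) ^ 2) m2 U)⁻¹ = (a⁻¹ : 𝕜) • 1 + covQ T M U * (covLapF (fine L M) ((L : ℝ) ^ 2) m2 U)⁻¹ * kingQadjU T M U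
      ∧ (∀ f : Tor M × n → 𝕜, a⁻¹ * ‖(toLp 2 f : EuclideanSpace 𝕜 (Tor M × n))‖ ^ 2 ≤ RCLike.re (star f ⬝ᵥ ((effLapU T M a ((L : ℝ) ^ 2) m2 U)⁻¹ *ᵥ f))
          ∧ RCLike.re (star f ⬝ᵥ ((effLapU T M a ((L : ℝ) ^ 2) m2 U)⁻¹ *ᵥ f)) ≤ (a⁻¹ + m2⁻¹) * ‖(toLp 2 f : EuclideanSpace 𝕜 (Tor M × n))‖ ^ 2)
      ∧ (∀ y y', ‖blk ((effLapU T M a ((L : ℝ) ^ 2) m2 U)⁻¹) y y'‖ ≤ (effLaplacian L M a ((L : ℝ) ^ 2) m2)⁻¹ y y') :=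
  ⟨effLapU_inv_eq_noise_add_blockAvg T M ha (by positivity) hm hU, fun f => king_blockField_covariance_sandwich T M ha (by positivity) hm hU f,
    fun y y' => norm_blk_effLapU_inv_le_king T M hL ha hm hU y y'⟩

end Summit.QuantumFields.YangMills.BalabanUVNodes.N15KingModelRung.CovariantBlock

end
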